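import Summits.AnomalousDissipation.AnomalousDissipation.Theorems.BaireTransferRobustLoudUpgradeLine
import Summits.AnomalousDissipation.AnomalousDissipation.Theorems.BaireTransferRobustLoudUpgradeStubSteadyPersist
import Summits.AnomalousDissipation.AnomalousDissipation.Theorems.BaireTransferRobustLoudUpgradeStubPeriodicWindow
import Summits.AnomalousDissipation.AnomalousDissipation.Theorems.BaireTransferRobustLoudUpgradePeriodicPersistOfHenry
import Literature.Analysis.FluidPDE.PeriodicNSOrbitPersistsProofs
import Literature.Analysis.FluidPDE.LongTimeAverageNonneg
import Summits.AnomalousDissipation.AnomalousDissipation.Theorems.BaireTransferRobustLoudUpgradeStubWindowExhaust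
import Summits.AnomalousDissipation.AnomalousDissipation.Theorems.BaireTransferRobustLoudUpgradeStubOrbitInW
import Summits.AnomalousDissipation.AnomalousDissipation.Theorems.BaireTransferRobustLoudUpgradeStubLimitEquation
import Summits.AnomalousDissipation.AnomalousDissipation.Theorems.BaireTransferRobustLoudUpgradeStubRealizeTempered
import Summits.AnomalousDissipation.AnomalousDissipation.Theorems.BaireTransferRobustLoudUpgradeStubBudgetLimit
import Summits.AnomalousDissipation.AnomalousDissipation.Theorems.BaireTransferRobustLoudUpgradeTemperedClosed

/-!
# Stub `stub_windowExhaust2` of the line `malkin-cone-group-orbits`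
# (crux stmt-AnomalousDissipation-1144, `BaireTransfer.RobustLoudUpgrade`, lead c16, cycle 2:
# generic persistence for all witnesses)

**Window exhaustion for the budget-free lattice-tempered correspondence.**  The budget-free
lattice-tempered correspondence `𝚽[S, n] c` of the window `n : ℕ` collects the data
`(ν, τ, m, x)` — viscosity, period, mean `m = ∫ u(0)`, weighted space–time lattice state
`x = Λ û ∈ ℓ²(ℤ × ℤ³; ℂ³)` — of the classical `τ`-periodic orbits `u, p` of `NS_ν(f_c)` on `ℝ × T³`
with `ν, τ ∈ [1/(n+1), n+1]`, `‖m‖ ≤ n + 1` and `∑ Λ ‖x‖² ≤ n + 1`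
(`û = 𝓕(complexify ∘ (timeRoll τ u − ∫ u(0)))`, `Λ(m,k) = |m| + |k|²`).

THIS STUB: every classical `τ`-periodic orbit (`0 < ν`, `0 < τ`) IS such a datum for every large
`n`.  The only non-elementary input is the rapid decay of `û` for a classical periodic orbit
(`TimePeriodicLattice.orbit_rapidDecay`), which makes every parabolic moment of `Λ û` finite
(`TimePeriodicLattice.moments_of_rapidDecay`): the zeroth moment packages `Λ û` as an element of
`ℓ²` (`TimePeriodicLattice.memℓp_two_of_tsum_ne_top`), the first moment is the window's weighted
budget, and the six window conditions then hold for every large `n` (archimedean property).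

References: G. Iooss, Arch. Rational Mech. Anal. 47 (1972), §2 (space–time Fourier data of
periodic orbits); the vocabulary module `Theorems/BaireTransferRobustLoudUpgradeLine.lean`; the
lattice suite `Literature/Analysis/FluidPDE/TimePeriodicNSLattice*.lean`, the template
`Literature/Analysis/FluidPDE/PeriodicNSOrbitPersistsProofs.lean` (`persists_main`) and the wave-1
twin `Theorems/BaireTransferRobustLoudUpgradeStubWindowExhaust.lean` (`stub_windowExhaust`).
-/

set_option linter.dupNamespace false

noncomputable section

open scoped BigOperators Topology ENNReal NNReal ComplexConjugate
open Filter Set Function TopologicalSpace MeasureTheory UnitAddTorus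

namespace Summit.AnomalousDissipation.AnomalousDissipation.Theorems.RobustLoudUpgrade.Tempered

open Literature.Analysis.FunctionSpaces Literature.Analysis.FunctionSpaces.Torus
open Literature.Analysis.FunctionSpaces.EuclideanSpace
open Literature.Analysis.FluidPDE Literature.Analysis.FluidPDE.ScalarFourier
open Literature.Analysis.FluidPDE.TimePeriodicLattice
open Summit.AnomalousDissipation.AnomalousDissipation.Theses.BaireTransfer
open Summit.AnomalousDissipation.AnomalousDissipation.Theorems.RobustLoudUpgrade

-- NOTATION START (verbatim the local notations of `Literature/Analysis/FluidPDE/PeriodicNSOrbitPersistsProofs.lean`)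
/-- The flat unit torus `T³`. -/
local notation "𝕋³" => UnitAddTorus (Fin 3)
/-- Real velocity values. -/
local notation "ℝ³" => EuclideanSpace ℝ (Fin 3)
/-- Complex coefficient values. -/
local notation "ℂ³" => EuclideanSpace ℂ (Fin 3)

/-- Local notation: the parabolic weight `Λ(n, k) = |n| + |k|²`. -/
local notation:max "Λ" m:max => (|((Prod.fst m : ℤ) : ℝ)| + freqNormSq (Prod.snd m))

/-- Local notation: the convective symbol on `ℤ × ℤ³` (as in `TimePeriodicNSLattice`). -/
local notation:max "𝐍[" a ", " b "]" m:max =>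
  (WithLp.toLp 2 (fun p : Fin 3 => ∑ j : Fin 3, ∑' m' : ℤ × (Fin 3 → ℤ),
    a m' j * (dsym j (Prod.snd m - Prod.snd m') * b (m - m') p)) : EuclideanSpace ℂ (Fin 3))

/-- Local notation: division by the weight. -/
local notation:max "𝐜" x:max => (fun mm : ℤ × (Fin 3 → ℤ) =>
  ((((|((Prod.fst mm : ℤ) : ℝ)| + freqNormSq (Prod.snd mm))⁻¹ : ℝ) : ℂ) • x mm))

/-- Local notation: multiplication by the weight. -/
local notation:max "𝐬" x:max => (fun mm : ℤ × (Fin 3 → ℤ) =>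
  ((((|((Prod.fst mm : ℤ) : ℝ)| + freqNormSq (Prod.snd mm)) : ℝ) : ℂ) • x mm))

/-- Local notation: the family of coefficients of `x ∈ W ⊂ ℓ²`. -/
local notation:max "𝐰" x:max =>
  (((x : lp (fun _ : ℤ × (Fin 3 → ℤ) => EuclideanSpace ℂ (Fin 3)) 2)) : ℤ × (Fin 3 → ℤ) → EuclideanSpace ℂ (Fin 3))

/-- Local notation: the symbol `σ_om(n,k) = 2πi om n + 4π²ν|k|² + 2πi m₀·k`. -/
local notation "σ[" om ", " ν ", " m₀ "]" => (fun mm : ℤ × (Fin 3 → ℤ) =>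
  2 * Real.pi * Complex.I * ((om : ℝ) : ℂ) * ((Prod.fst mm : ℤ) : ℂ) +
    (((4 * Real.pi ^ 2 * ν * freqNormSq (Prod.snd mm) : ℝ)) : ℂ) +
    2 * Real.pi * Complex.I * (∑ jj : Fin 3, ((m₀ jj : ℝ) : ℂ) * (((Prod.snd mm) jj : ℤ) : ℂ)))

/-- Local notation: the lattice family of the orbit `u` with period `τ`:
`û(n,k) = 𝓕(complexify ∘ (timeRoll τ u − ∫ u(0)))(n,k)`. -/
local notation:max "𝐨[" τ ", " u "]" => (fun mm : ℤ × (Fin 3 → ℤ) =>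
  mFourierCoeff (EuclideanSpace.complexify ∘ fun y : UnitAddTorus (Fin 4) => Torus.timeRoll τ u y - ∫ x, u 0 x)
    (Fin.cons (Prod.fst mm) (Prod.snd mm) : Fin 4 → ℤ))

/-- Local notation: the force family `y_F(n,k) = [k ≠ 0][n = 0] 𝓕(complexify ∘ F)(k)`. -/
local notation:max "𝐲" F:max => (fun mm : ℤ × (Fin 3 → ℤ) =>
  (ite (Prod.snd mm = 0) (0 : EuclideanSpace ℂ (Fin 3))
    (ite (Prod.fst mm = 0) (mFourierCoeff (EuclideanSpace.complexify ∘ F) (Prod.snd mm)) 0)))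

/-- Local notation: the family of coefficients of an element of `ℓ²(ℤ × ℤ³; ℂ³)`. -/
local notation:max "𝐯" x:max =>
  ((x : lp (fun _ : ℤ × (Fin 3 → ℤ) => EuclideanSpace ℂ (Fin 3)) 2) : ℤ × (Fin 3 → ℤ) → EuclideanSpace ℂ (Fin 3))

/-- Local notation: the BUDGET-FREE LATTICE-TEMPERED CORRESPONDENCE of the window `n` — to a coefficient vector `c` the set of data
`(ν, τ, m, x)` (viscosity, period, mean, weighted lattice state `x = Λû ∈ ℓ²`) of the classical time-periodic solutions of `NS_ν(f_c)`
with `ν, τ ∈ [1/(n+1), n+1]`, `‖m‖ ≤ n+1`, `Σ Λ‖x‖² ≤ n+1`. -/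
local notation "𝚽[" S ", " n "]" => (fun c : Coeff S => setOf
  (fun q : ℝ × ℝ × (EuclideanSpace ℝ (Fin 3) × lp (fun _ : ℤ × (Fin 3 → ℤ) => EuclideanSpace ℂ (Fin 3)) 2) =>
    1 / ((n : ℝ) + 1) ≤ (Prod.fst q) ∧ (Prod.fst q) ≤ (n : ℝ) + 1 ∧ 1 / ((n : ℝ) + 1) ≤ (Prod.fst (Prod.snd q)) ∧ (Prod.fst (Prod.snd q)) ≤ (n : ℝ) + 1 ∧
    ‖(Prod.fst (Prod.snd (Prod.snd q)))‖ ≤ (n : ℝ) + 1 ∧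
    (∑' mm : ℤ × (Fin 3 → ℤ), ENNReal.ofReal (Λ mm) * ‖(𝐯 ((Prod.snd (Prod.snd (Prod.snd q))))) mm‖ₑ ^ 2) ≤ ENNReal.ofReal ((n : ℝ) + 1) ∧
    ∃ (u : ℝ → UnitAddTorus (Fin 3) → EuclideanSpace ℝ (Fin 3)) (p : ℝ → UnitAddTorus (Fin 3) → ℝ),
      IsClassicalNSSolutionOn Set.univ (Prod.fst q) (fun _ => force S c) u p ∧ Function.Periodic u (Prod.fst (Prod.snd q)) ∧
      (∫ y, u 0 y) = (Prod.fst (Prod.snd (Prod.snd q))) ∧ 𝐯 ((Prod.snd (Prod.snd (Prod.snd q)))) = 𝐬 𝐨[(Prod.fst (Prod.snd q)), u]))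
-- NOTATION END

namespace StubWindowExhaust2Aux

/-- The archimedean step: the scalar window conditions `1/(N+1) ≤ ν ≤ N + 1` hold for every
`N` above the thresholds `1/ν` and `ν`. [folklore] -/
theorem window_of_thresholds {ν N : ℝ} (hν : 0 < ν) (hN : 0 ≤ N) (hA : 1 / ν ≤ N) (hB : ν ≤ N) :
    1 / (N + 1) ≤ ν ∧ ν ≤ N + 1 := by
  have hA' : 1 ≤ N * ν := (div_le_iff₀ hν).1 hA
  refine ⟨?_, by linarith⟩
  rw [div_le_iff₀ (by positivity)]
  nlinarith

/-- A finite `ℝ≥0∞` quantity is below `ofReal (N + 1)` once `N` is above its real part. [folklore] -/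
theorem le_ofReal_of_toReal_le {M : ℝ≥0∞} (hM : M ≠ ⊤) {N : ℝ} (hN : M.toReal ≤ N) :
    M ≤ ENNReal.ofReal (N + 1) := by
  rw [← ENNReal.ofReal_toReal hM]
  exact ENNReal.ofReal_le_ofReal (by linarith)

end StubWindowExhaust2Aux

/-- **Window exhaustion for the budget-free correspondence** (every classical periodic orbit is a
datum of some window): for a classical `τ`-periodic solution `u, p` of `NS_ν(f_c)` (`0 < ν`,
`0 < τ`) the weighted lattice state `x = Λ û` is square summable (rapid decay of the space–time
Fourier data of a classical periodic orbit, Iooss 1972, §2, and its parabolic moments), and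
`(ν, τ, ∫ u(0), x) ∈ 𝚽[S, n] c` for every large `n` (archimedean property). [folklore] -/
theorem stub_windowExhaust2 : ∀ (S : Finset (Fin 3 → ℤ)) (c : Coeff S) (ν τ : ℝ)
    (u : ℝ → 𝕋³ → ℝ³) (p : ℝ → 𝕋³ → ℝ), 0 < ν → 0 < τ →
    IsClassicalNSSolutionOn Set.univ ν (fun _ => force S c) u p → Function.Periodic u τ →
    ∃ (n : ℕ) (x : lp (fun _ : ℤ × (Fin 3 → ℤ) => EuclideanSpace ℂ (Fin 3)) 2),
      ((ν, τ, ((∫ y, u 0 y), x)) : ℝ × ℝ × (EuclideanSpace ℝ (Fin 3) × lp (fun _ : ℤ × (Fin 3 → ℤ) => EuclideanSpace ℂ (Fin 3)) 2))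
        ∈ 𝚽[S, n] c ∧ 𝐯 x = 𝐬 𝐨[τ, u] := by
  intro S c ν τ u p hν hτ hsol hper
  -- every parabolic moment of the weighted lattice data `Λ û` is finite (rapid decay)
  have hur := orbit_rapidDecay hsol hper
  have hmom : ∀ N : ℕ, ∑' m : ℤ × (Fin 3 → ℤ), ENNReal.ofReal ((Λ m) ^ N) * ‖(𝐬 (𝐨[τ, u])) m‖ₑ ^ 2 ≠ ⊤ := fun N =>
    moments_of_rapidDecay (C := mFourierCoeff (complexify ∘ fun y => timeRoll τ u y - ∫ x, u 0 x)) hur N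
  -- the zeroth moment: `Λ û ∈ ℓ²`
  have h2 : ∑' m : ℤ × (Fin 3 → ℤ), ‖(𝐬 (𝐨[τ, u])) m‖ₑ ^ 2 ≠ ⊤ := by
    have := hmom 0; simpa only [pow_zero, ENNReal.ofReal_one, one_mul] using this
  -- the first moment: the weighted budget of the window
  have hM : ∑' m : ℤ × (Fin 3 → ℤ), ENNReal.ofReal (Λ m) * ‖(𝐬 (𝐨[τ, u])) m‖ₑ ^ 2 ≠ ⊤ := by
    have := hmom 1; simpa only [pow_one] using this
  set x : lp (fun _ : ℤ × (Fin 3 → ℤ) => EuclideanSpace ℂ (Fin 3)) 2 := ⟨𝐬 (𝐨[τ, u]), memℓp_two_of_tsum_ne_top h2⟩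
    with hxdef
  have hvx : 𝐯 x = 𝐬 𝐨[τ, u] := rfl
  set M : ℝ≥0∞ := ∑' m : ℤ × (Fin 3 → ℤ), ENNReal.ofReal (Λ m) * ‖(𝐬 (𝐨[τ, u])) m‖ₑ ^ 2 with hMdef
  -- choose `n` above all thresholds
  obtain ⟨n, hn⟩ := exists_nat_ge (max (max (max (1 / ν) ν) (max (1 / τ) τ)) (max ‖∫ y, u 0 y‖ M.toReal))
  simp only [max_le_iff] at hn
  obtain ⟨⟨⟨hA, hB⟩, hC, hD⟩, hE, hF⟩ := hn
  obtain ⟨h₁, h₂⟩ := StubWindowExhaust2Aux.window_of_thresholds hν (Nat.cast_nonneg n) hA hB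
  obtain ⟨h₃, h₄⟩ := StubWindowExhaust2Aux.window_of_thresholds hτ (Nat.cast_nonneg n) hC hD
  have h₅ : ‖∫ y, u 0 y‖ ≤ (n : ℝ) + 1 := by linarith
  have h₆ : M ≤ ENNReal.ofReal ((n : ℝ) + 1) := StubWindowExhaust2Aux.le_ofReal_of_toReal_le hM hF
  refine ⟨n, x, ?_, hvx⟩
  simp only [Set.mem_setOf_eq]
  exact ⟨h₁, h₂, h₃, h₄, h₅, h₆, u, p, hsol, hper, rfl, hvx⟩

end Summit.AnomalousDissipation.AnomalousDissipation.Theorems.RobustLoudUpgrade.Tempered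

end
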